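import Mathlib
import Summits.CriticalPhenomena.SAWScalingLimit.Theorems.SAWRestrictionRigidityAxiomsOfLimitMarkovClockInverse
import Summits.CriticalPhenomena.SAWScalingLimit.Theorems.SAWRestrictionRigidityAxiomsOfLimitMarkovIntrinsicClock
import Summits.CriticalPhenomena.SAWScalingLimit.Theorems.SAWRestrictionRigidityAxiomsOfLimitMarkovStrictExtension
import Literature.Probability.RandomPlanarGeometry.CurveClassStopAtMeasurable
import HarnessLib

/-!
# The clock parametrisation of planar curves: locality on heads and the hitting-time identity

Crux `AxiomsOfLimit` (stmt-CriticalPhenomena-1370), line `registered`, stub `stub_markovOfLimit`: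
soft-Markov brick Λb2 "clock parametrisation: locality on heads and the hitting-time identity"
(lead c4); registered sub-stub `stub_clockLocality`. Theorems only.

Fix a radius `R > 0`, put `W := volume (closedBall 0 R)` and let
`clk γ s := ∫ x in closedBall 0 R, exp (-infDist x (γ ∘ affineClamp 0 s).range)` be the intrinsic
clock of the head `γ|[0, s]` of a curve `γ` (files `…IntrinsicClock`, `…ClockInverse`). For a
simple curve `γ` inside `ball 0 R` the shifted clock `φ s := clk γ s - clk γ 0` is continuous,
strictly increasing and `< W`, and the CLOCK PARAMETRISATION is
`Λ γ r := γ (sInf {s | r W ≤ φ s})` (an `sInf` in the complete lattice `unitInterval`). This file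
proves:

* (LOCALITY) for the head `η := γ ∘ affineClamp 0 s₀` one has `clk η s = clk γ (s₀ s)` (the head
  of `η` at `s` has the range of the head of `γ` at `s₀ s`, `ClockInverse.range_head_comp`), so
  `Λ η r = Λ γ r` as long as `r W ≤ φ s₀` (the infimum of the preimage of the closed up-set
  `{t | r W ≤ φ t}` under `s ↦ s₀ s` is mapped to its infimum, which is `≤ s₀`,
  `ClockLocality.apply_sInf_preimage_of_mem_range`), and `Λ η r = γ s₀` once `φ s₀ ≤ r W`
  (the preimage is empty or consists of points `s` with `φ s₀ ≤ φ (s₀ s)`, i.e. `s₀ ≤ s₀ s`);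
* (HITTING) for a closed set `F` met by `γ`, with first hitting parameter `h := hitParam F γ`,
  `W · sInf {r | Λ γ r ∈ F} = φ h`: the generalised inverse is a genuine inverse
  (`ClockLocality.apply_sInf_sub_eq`: `φ (sInf {s | a ≤ φ s}) = a` for `0 ≤ a ≤ φ 1`, by the
  intermediate value theorem and strict monotonicity), so `Λ γ (φ h / W) = γ h ∈ F`, while
  `Λ γ r ∈ F` forces `h ≤ sInf {s | r W ≤ φ s}` (`Curve.hitParam_le`) and hence `φ h ≤ r W`.

They are assembled in `stub_clockLocality`.

References: G. F. Lawler, O. Schramm, W. Werner, Acta Math. 187 (2001), §2 (parametrisation of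
initial segments by a functional of the hull); M. Aizenman, A. Burchard, Duke Math. J. 99 (1999),
§2.1 (the curve space). All [folklore].
-/

noncomputable section

open MeasureTheory Filter Topology Set Metric
open scoped ENNReal unitInterval

namespace Summit.CriticalPhenomena.SAWScalingLimit.Theorems.AxiomsOfLimitMarkov

open Literature.Probability.RandomPlanarGeometry

/-! ### Two order lemmas on generalised inverses in the unit interval -/

/-- A continuous monotone self-map `m` of `[0, 1]` maps the infimum of the preimage of a closed set
`T ⊆ [0, 1]` to the infimum of `T`, provided the latter lies in the range of `m` (both infima in
the complete lattice `[0, 1]`, `sInf ∅ = 1`). [folklore] -/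
theorem ClockLocality.apply_sInf_preimage_of_mem_range {m : I → I} (hmc : Continuous m)
    (hmm : Monotone m) {T : Set I} (hT : IsClosed T) (h : sInf T ∈ Set.range m) :
    m (sInf (m ⁻¹' T)) = sInf T := by
  obtain ⟨s₀, hs₀⟩ := h
  rcases T.eq_empty_or_nonempty with rfl | hne
  · rw [Set.preimage_empty, sInf_empty]
    rw [sInf_empty] at hs₀
    exact le_antisymm le_top (hs₀.symm.le.trans (hmm le_top))
  · have hs₀S : s₀ ∈ m ⁻¹' T := by
      rw [mem_preimage, hs₀]
      exact IsClosed.sInf_mem hne hT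
    have hmemS : sInf (m ⁻¹' T) ∈ m ⁻¹' T := IsClosed.sInf_mem ⟨s₀, hs₀S⟩ (hT.preimage hmc)
    exact le_antisymm ((hmm (sInf_le hs₀S)).trans_eq hs₀) (sInf_le hmemS)

/-- For a continuous strictly increasing `f : [0, 1] → ℝ` and a level `0 ≤ a ≤ f 1 - f 0`, the
generalised inverse `sInf {s | a ≤ f s - f 0}` is a genuine inverse: `f - f 0` takes the value `a`
there (intermediate value theorem; the up-set is `Ici` of the preimage point). [folklore] -/
theorem ClockLocality.apply_sInf_sub_eq {f : I → ℝ} (hfm : StrictMono f) (hfc : Continuous f)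
    {a : ℝ} (h0 : 0 ≤ a) (h1 : a ≤ f 1 - f 0) :
    f (sInf {s : I | a ≤ f s - f 0}) - f 0 = a := by
  obtain ⟨s, hs⟩ : a ∈ Set.range fun x : I => f x - f 0 :=
    intermediate_value_univ 0 1 (hfc.sub continuous_const) ⟨(sub_self (f 0)).le.trans h0, h1⟩
  have hs' : f s - f 0 = a := hs
  have hS : {s' : I | a ≤ f s' - f 0} = Set.Ici s := Set.ext fun s' => by
    rw [mem_setOf_eq, mem_Ici, ← hs', sub_le_sub_iff_right, hfm.le_iff_le]
  rw [hS, csInf_Ici, hs']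

/-! ### Assembly -/

/-- **Λb2, locality and hitting times of the clock parametrisation** (crux `AxiomsOfLimit`,
registered stub `stub_clockLocality`): for `R > 0`, `W := volume (closedBall 0 R)`, the clock
`clk γ s` of the head `γ|[0, s]` and `Λ γ r := γ (sInf {s | r W ≤ clk γ s - clk γ 0})`, for every
simple curve `γ` in `ball 0 R`:
(LOCALITY) the clock path of the head `γ|[0, s₀]` agrees with that of `γ` at every `r` with
`r W ≤ clk γ s₀ - clk γ 0` and sits at `γ s₀` at every `r` with `clk γ s₀ - clk γ 0 ≤ r W`;
(HITTING) for a closed set `F` met by `γ`,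
`W · sInf {r | Λ γ r ∈ F} = clk γ (hitParam F γ) - clk γ 0`. [folklore] -/
theorem stub_clockLocality : ∀ (R : ℝ), 0 < R → let W : ℝ := (MeasureTheory.volume (Metric.closedBall (0:ℂ) R)).toReal; let clk : Literature.Probability.RandomPlanarGeometry.Curve ℂ → unitInterval → ℝ := fun γ s => ∫ x in Metric.closedBall (0:ℂ) R, Real.exp (-Metric.infDist x (⟨(γ).toContinuousMap.comp (Literature.Probability.RandomPlanarGeometry.Curve.affineClamp 0 s)⟩ : Literature.Probability.RandomPlanarGeometry.Curve ℂ).range); let Λ : Literature.Probability.RandomPlanarGeometry.Curve ℂ → unitInterval → ℂ := fun γ r => γ (sInf {s : unitInterval | (r : ℝ) * W ≤ clk γ s - clk γ 0}); (∀ γ : Literature.Probability.RandomPlanarGeometry.Curve ℂ, Function.Injective γ → γ.range ⊆ Metric.ball (0:ℂ) R → ∀ (s₀ r : unitInterval), ((r : ℝ) * W ≤ clk γ s₀ - clk γ 0 → Λ (⟨(γ).toContinuousMap.comp (Literature.Probability.RandomPlanarGeometry.Curve.affineClamp 0 s₀)⟩ : Literature.Probability.RandomPlanarGeometry.Curve ℂ)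 r = Λ γ r) ∧ (clk γ s₀ - clk γ 0 ≤ (r : ℝ) * W → Λ (⟨(γ).toContinuousMap.comp (Literature.Probability.RandomPlanarGeometry.Curve.affineClamp 0 s₀)⟩ : Literature.Probability.RandomPlanarGeometry.Curve ℂ) r = γ s₀)) ∧ (∀ γ : Literature.Probability.RandomPlanarGeometry.Curve ℂ, Function.Injective γ → γ.range ⊆ Metric.ball (0:ℂ) R → ∀ F : Set ℂ, IsClosed F → (∃ t, γ t ∈ F) → ((sInf {r : unitInterval | Λ γ r ∈ F} : unitInterval) : ℝ) * W = clk γ (Set.projIcc 0 1 zero_le_one (γ.hitParam F)) - clk γ 0) := by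
  intro R hR W clk Λ
  have hcont : ∀ γ : Curve ℂ, Continuous (clk γ) := fun γ =>
    IntrinsicClock.continuous_integral_head R γ
  have hmono : ∀ γ : Curve ℂ, Monotone (clk γ) := fun γ => ClockInverse.monotone_integral_head R γ
  have hlt : ∀ (γ : Curve ℂ) (s : I), clk γ s - clk γ 0 < W := fun γ s =>
    ClockInverse.integral_sub_integral_lt hR _ _
  have hsm : ∀ γ : Curve ℂ, Function.Injective γ → γ.range ⊆ ball (0 : ℂ) R →
      StrictMono (clk γ) := fun γ hγ hγR => IntrinsicClock.strictMono_integral_head γ hγ hγR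
  refine ⟨fun γ hγ hγR s₀ r => ?_, fun γ hγ hγR F hF hex => ?_⟩
  · -- (LOCALITY)
    have hψa : ∀ u : I, Curve.affineClamp 0 (s₀ : ℝ) u = s₀ * u := fun u => by
      rw [Curve.affineClamp_apply, zero_add, Set.projIcc_of_mem _ (unitInterval.mul_mem s₀.2 u.2)]
      rfl
    have hψm : Monotone (Curve.affineClamp 0 (s₀ : ℝ)) := fun u v h => by
      rw [hψa, hψa]
      exact mul_le_mul_right h s₀
    have hψ0 : Curve.affineClamp 0 (s₀ : ℝ) 0 = 0 := by rw [hψa, mul_zero]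
    have hψ1 : Curve.affineClamp 0 (s₀ : ℝ) 1 = s₀ := by rw [hψa, mul_one]
    have hc : ∀ s, clk ⟨γ.toContinuousMap.comp (Curve.affineClamp 0 (s₀ : ℝ))⟩ s =
        clk γ (Curve.affineClamp 0 (s₀ : ℝ) s) := fun s =>
      congrArg (fun K : Set ℂ => ∫ x in closedBall (0 : ℂ) R, Real.exp (-infDist x K))
        (ClockInverse.range_head_comp γ hψm hψ0 s)
    have hT : IsClosed {t : I | (r : ℝ) * W ≤ clk γ t - clk γ 0} :=
      isClosed_le continuous_const ((hcont γ).sub continuous_const)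
    have hS : {s : I | (r : ℝ) * W ≤ clk ⟨γ.toContinuousMap.comp (Curve.affineClamp 0 (s₀ : ℝ))⟩ s -
        clk ⟨γ.toContinuousMap.comp (Curve.affineClamp 0 (s₀ : ℝ))⟩ 0} =
        Curve.affineClamp 0 (s₀ : ℝ) ⁻¹' {t : I | (r : ℝ) * W ≤ clk γ t - clk γ 0} :=
      Set.ext fun s => by rw [mem_setOf_eq, hc, hc, hψ0]; rfl
    have key : Λ ⟨γ.toContinuousMap.comp (Curve.affineClamp 0 (s₀ : ℝ))⟩ r =
        γ (Curve.affineClamp 0 (s₀ : ℝ) (sInf (Curve.affineClamp 0 (s₀ : ℝ) ⁻¹'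
          {t : I | (r : ℝ) * W ≤ clk γ t - clk γ 0}))) := by
      show (⟨γ.toContinuousMap.comp (Curve.affineClamp 0 (s₀ : ℝ))⟩ : Curve ℂ)
          (sInf {s : I | (r : ℝ) * W ≤
            clk ⟨γ.toContinuousMap.comp (Curve.affineClamp 0 (s₀ : ℝ))⟩ s -
              clk ⟨γ.toContinuousMap.comp (Curve.affineClamp 0 (s₀ : ℝ))⟩ 0}) = _
      rw [hS]
      rfl
    refine ⟨fun hr => ?_, fun hr => ?_⟩
    · -- before the clock of the head: the two clock paths agree
      have hrange : sInf {t : I | (r : ℝ) * W ≤ clk γ t - clk γ 0} ∈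
          Set.range (Curve.affineClamp 0 (s₀ : ℝ)) := by
        rw [ClockInverse.range_eq_Icc (Curve.affineClamp 0 (s₀ : ℝ)).continuous hψm, hψ0, hψ1]
        exact ⟨unitInterval.nonneg', sInf_le hr⟩
      rw [key, ClockLocality.apply_sInf_preimage_of_mem_range
        (Curve.affineClamp 0 (s₀ : ℝ)).continuous hψm hT hrange]
    · -- after the clock of the head: the clock path of the head is frozen at `γ s₀`
      have hfix : Curve.affineClamp 0 (s₀ : ℝ) (sInf (Curve.affineClamp 0 (s₀ : ℝ) ⁻¹'
          {t : I | (r : ℝ) * W ≤ clk γ t - clk γ 0})) = s₀ := by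
        refine le_antisymm ((hψm unitInterval.le_one').trans_eq hψ1) ?_
        rcases (Curve.affineClamp 0 (s₀ : ℝ) ⁻¹'
            {t : I | (r : ℝ) * W ≤ clk γ t - clk γ 0}).eq_empty_or_nonempty with he | hne
        · rw [he, sInf_empty, show (⊤ : I) = 1 from rfl, hψ1]
        · have hmem : (r : ℝ) * W ≤ clk γ (Curve.affineClamp 0 (s₀ : ℝ)
              (sInf (Curve.affineClamp 0 (s₀ : ℝ) ⁻¹'
                {t : I | (r : ℝ) * W ≤ clk γ t - clk γ 0}))) - clk γ 0 :=
            IsClosed.sInf_mem hne (hT.preimage (Curve.affineClamp 0 (s₀ : ℝ)).continuous)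
          exact (hsm γ hγ hγR).le_iff_le.1 (by linarith)
      rw [key, hfix]
  · -- (HITTING)
    have hW0 : 0 < W := by
      have h := hlt γ 0
      rwa [sub_self] at h
    have hfm : StrictMono (clk γ) := hsm γ hγ hγR
    obtain ⟨t₀, ht₀⟩ : ∃ t₀ : I, (t₀ : ℝ) = γ.hitParam F := ⟨⟨_, γ.hitParam_mem_Icc F⟩, rfl⟩
    have hproj : Set.projIcc (0 : ℝ) 1 zero_le_one (γ.hitParam F) = t₀ := by
      rw [← ht₀, Set.projIcc_val]
    have hmemF : γ t₀ ∈ F := by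
      rw [← hproj, Set.projIcc_of_mem _ (γ.hitParam_mem_Icc F)]
      exact Curve.apply_hitParam_mem hF hex
    rw [hproj]
    have h0 : ∀ s, 0 ≤ clk γ s - clk γ 0 := fun s => sub_nonneg.2 (hmono γ unitInterval.nonneg')
    have h1 : ∀ s, clk γ s - clk γ 0 ≤ clk γ 1 - clk γ 0 := fun s =>
      sub_le_sub_right (hmono γ unitInterval.le_one') _
    obtain ⟨r₀, hr₀⟩ : ∃ r₀ : I, (r₀ : ℝ) = (clk γ t₀ - clk γ 0) / W :=
      ⟨⟨_, div_nonneg (h0 t₀) hW0.le, (div_le_one hW0).2 ((h1 t₀).trans_lt (hlt γ 1)).le⟩, rfl⟩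
    have hr₀W : (r₀ : ℝ) * W = clk γ t₀ - clk γ 0 := by rw [hr₀, div_mul_cancel₀ _ hW0.ne']
    have hinv : ∀ r : I, (r : ℝ) * W ≤ clk γ 1 - clk γ 0 →
        clk γ (sInf {s : I | (r : ℝ) * W ≤ clk γ s - clk γ 0}) - clk γ 0 = (r : ℝ) * W :=
      fun r hr => ClockLocality.apply_sInf_sub_eq hfm (hcont γ) (mul_nonneg r.2.1 hW0.le) hr
    have hsInf : sInf {r : I | Λ γ r ∈ F} = r₀ := by
      refine le_antisymm (sInf_le ?_) (le_sInf fun r hr => ?_)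
      · -- `Λ γ r₀ = γ t₀ ∈ F`
        show γ (sInf {s : I | (r₀ : ℝ) * W ≤ clk γ s - clk γ 0}) ∈ F
        have he : clk γ (sInf {s : I | (r₀ : ℝ) * W ≤ clk γ s - clk γ 0}) = clk γ t₀ := by
          have h := hinv r₀ (hr₀W.trans_le (h1 t₀))
          linarith
        rw [hfm.injective he]
        exact hmemF
      · -- `Λ γ r ∈ F` forces `t₀ ≤ sInf {s | r W ≤ clk γ s - clk γ 0}`, hence `r₀ ≤ r`
        have hr' : γ (sInf {s : I | (r : ℝ) * W ≤ clk γ s - clk γ 0}) ∈ F := hr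
        have ht₀le : t₀ ≤ sInf {s : I | (r : ℝ) * W ≤ clk γ s - clk γ 0} :=
          Subtype.coe_le_coe.1 (ht₀.trans_le (Curve.hitParam_le hr'))
        show (r₀ : ℝ) ≤ r
        rw [hr₀, div_le_iff₀ hW0]
        rcases le_or_gt ((r : ℝ) * W) (clk γ 1 - clk γ 0) with hle | hgt
        · have h2 := hinv r hle
          have h3 := hmono γ ht₀le
          linarith
        · exact (h1 t₀).trans hgt.le
    rw [hsInf, hr₀W]

end Summit.CriticalPhenomena.SAWScalingLimit.Theorems.AxiomsOfLimitMarkov
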